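import Mathlib.FieldTheory.KrullTopology
import Mathlib.FieldTheory.AbsoluteGaloisGroup
import Mathlib.FieldTheory.IntermediateField.Adjoin.Basic
import Mathlib.Algebra.MvPolynomial.PDeriv
import Mathlib.RingTheory.MvPolynomial.Homogeneous
import Mathlib.LinearAlgebra.Dimension.Finrank
import Mathlib.LinearAlgebra.FiniteDimensional.Basic
import Mathlib.LinearAlgebra.Matrix.ToLin
import Mathlib.LinearAlgebra.Matrix.BilinearForm
import Mathlib.LinearAlgebra.Matrix.GeneralLinearGroup.Defs
import Mathlib.LinearAlgebra.Quotient.Basic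
import Mathlib.LinearAlgebra.BilinearMap
import Mathlib.LinearAlgebra.Finsupp.LSum
import Mathlib.LinearAlgebra.Finsupp.LinearCombination
import Mathlib.RepresentationTheory.Basic
import Mathlib.Topology.Instances.ZMod
import Mathlib.Topology.Algebra.OpenSubgroup
import Literature.NumberTheory.GaloisRepresentations.GaloisRep
import HarnessLib

/-!
# Lines on a cubic surface and the mod-3 orthogonal Galois representation

For a cubic form `F ∈ k[x₀,…,x₃]` (the case wanted downstream: `k = ℚ`, `F` smooth) this file
constructs, with real definitions and no unproved hypothesis,

* `CubicSurface.IsSmoothCubic F` — `F` homogeneous of degree `3`, `F` and `∇F` without common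
  zero in `ℙ³(k̄)`;
* `CubicSurface.lines K F` — the set of lines of the surface `F = 0` with coordinates in an
  extension `K/k` (`2`-planes `W ⊆ K⁴` on which `F` vanishes), with the action
  (`CubicSurface.linesMulAction`) of any group `G` acting on `K` by `k`-algebra automorphisms
  (`[MulSemiringAction G K] [SMulCommClass G k K]`; e.g. `G = K ≃ₐ[k] K`, or Mathlib's
  `Field.absoluteGaloisGroup k` on `K = k̄` through the instances of
  `Literature.NumberTheory.GaloisRepresentations.AbsGaloisGroup`), via the conjugation
  `galConj σ W = σ • W` of subspaces of `K^ι` (a lattice automorphism preserving `finrank`);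
* the intersection numbers `interNum` (`ℓ² = -1`, `ℓ·ℓ' ∈ {0, 1}` for `ℓ ≠ ℓ'` according as the
  lines are skew or meet), the intersection form mod `3` on `𝔽₃^{(lines)}` (`interFormMod3`),
  the augmentation `aug` (`= · h mod 3`, `h` the hyperplane class, `h·ℓ = 1`), the sum-zero
  submodule `N = ker aug` (`sumZero`), the radical of the form on it (`sumZeroRad`), and the
  **quadratic space of the lines** `V(F) = N / rad N` (`LinesQuadSpace`) with its nondegenerate
  symmetric form `q` (`linesQuadForm`, `linesQuadForm_nondegenerate`) and the induced
  `q`-orthogonal representation `linesQuadRep` of `G` (`linesQuadForm_linesQuadRep`);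
* `CubicSurface.LineFrame K F` — an orthonormal-type frame: a basis of `V(F)` over `𝔽₃` in
  which `q` is a unit multiple of the sum-of-squares form; in such a frame the matrices of the
  action are orthogonal (`LineFrame.transpose_mul_matrixRep`), and `detTwist : g ↦ det(g)·g`
  turns them into elements of `SO₅(𝔽₃) = {g | gᵀg = 1, det g = 1}`
  (`LineFrame.orthogonalRep`, `transpose_mul_orthogonalRep`, `det_orthogonalRep`);
* continuity: stabilizers of `k̄`-subspaces are open in the Krull topology
  (`isOpen_setOf_galConj_eq`), so when the lines are finitely many the representation is trivial
  on an open subgroup (`LineFrame.galoisRep : FramedGaloisRep k (ZMod 3) 5`);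
* **`CubicSurface.linesOrthogonalRep F : FramedGaloisRep k (ZMod 3) 5`** — the mod-3
  orthogonal Galois representation `σ ↦ det(w_σ)·w_σ` of `Gal(k̄/k)` in a chosen frame
  (`Classical.choice`; well defined up to `O₅(𝔽₃)`-conjugation), with the API
  `transpose_mul_linesOrthogonalRep` (`ρ(σ)ᵀρ(σ) = 1`), `det_linesOrthogonalRep` (`det = 1`),
  `linesOrthogonalRep_eq_one_of_forall_smul_eq` (trivial on the pointwise stabilizer of the
  lines, i.e. it factors through `Gal(k(lines)/k)`), `linesOrthogonalRep_eq` (unfolding).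
  JUNK VALUE: the trivial representation if the lines are infinitely many or no frame exists;
  by the theorem of the `27` lines neither happens for a smooth cubic form.

## The mathematics and the sources

For a smooth cubic surface `S = {F = 0} ⊆ ℙ³` over `k̄`: `S` contains exactly `27` lines, each of
self-intersection `-1`, `Pic S ≅ ℤ⁷ = ℤ^{1,6}` is generated by them, the hyperplane class is
`h = -K_S` [Hartshorne1977, V Prop 4.8, Thm 4.9], and the group of permutations of the `27` lines
preserving incidences is `W(E₆)`, of order `51840` [Hartshorne1977, V Rem 4.10.1, Ex 4.11].
Allcock–Carlson–Toledo [AllcockCarlsonToledo2002, (3.2), (4.8)]: `L(S) = H²(S, ℤ) ≅ ℤ^{1,6}`,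
`L₀(S) = η(S)^⊥` (`η(S) = h`) is a copy of `-E₆` of determinant `3`, and
`V(S) := L₀(S)/3L₀'(S)` (`L₀'` the dual lattice; inner products reduced mod `3`) is a
nondegenerate quadratic space of dimension five over `𝔽₃` [Bourbaki, Lie VI §4 Ex. 2] on which
`Aut(L(S), η(S)) ≅ W(E₆)` acts faithfully; moreover `P Aut(V) = PGO₅(3) ≅ W(E₆)`
[AllcockCarlsonToledo2002, (2.12), (3.12)], and `V(S)` is Galois-equivariantly the reduction
`Λ(T)/θΛ(T)` of the Eisenstein lattice `H³(T, ℤ)` of the cyclic cubic threefold `T → ℙ³`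
branched along `S` [AllcockCarlsonToledo2002, (4.8)–(4.10)] — the reason the requesting route
(Langlands/CubicSurfaceE6Transport, crux `OccultSystemIsE6Type`) wants this representation.
Since `O(V) = SO(V) × {±1}` (odd dimension) and `W(E₆) ↪ O(V)` contains reflections but not `-1`,
`w ↦ det(w)·w` maps `W(E₆)` isomorphically onto `SO₅(𝔽₃)` (orders `51840`); for the
pentahedral family the image of `Gal(ℚ̄/ℚ)` lies in the index-two subgroup `D¹W(E₆)` iff `-3Δ`
is a square [ElsenhansJahnel2011, Thm 2.12].

**Why `V(F) = N / rad N` is `V(S)`** (design choice: this presentation needs neither `Pic S` nor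
the finiteness of the set of lines, so every definition above is total).  Let `X = 𝔽₃^{(lines)}`
and `π : X ↠ P̄ := Pic S ⊗ 𝔽₃` (the lines generate `Pic S`); `interFormMod3 = π^*(·,·)` and `P̄`
is nondegenerate (`Pic S` is unimodular), so `rad(X) = ker π`.  Since `h·ℓ = 1` for every line,
`aug = (π(·), h̄)`, hence `π(N) = h̄^⊥` (all of it, `π` being onto), and `h̄^⊥ = L₀(S)/3L₀(S)`
(`L₀ ∩ 3·Pic = 3L₀` as `x = 3y, x·h = 0 ⇒ y·h = 0`; both sides have dimension `6`).  The radical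
of `h̄^⊥` is `h̄^⊥ ∩ (h̄^⊥)^⊥ = h̄^⊥ ∩ 𝔽₃h̄ = 𝔽₃h̄` (`h² = 3 ≡ 0`), which corresponds to
`3L₀'(S)/3L₀(S)`.  Therefore `N / rad N ≅ h̄^⊥ / 𝔽₃h̄ ≅ L₀(S)/3L₀'(S) = V(S)`, isometrically
and equivariantly for every incidence-preserving permutation of the lines; `dim V(F) = 5`.

## Design notes

* Generality: any base field `k`, any extension `K` for the lines, any group `G` of
  `k`-automorphisms of `K` for the actions; the Galois representation itself is over
  `Field.absoluteGaloisGroup k` acting on `K = AlgebraicClosure k`, as in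
  `Literature.NumberTheory.GaloisRepresentations.FramedGaloisRep`.
* No instance is declared on a Mathlib type: the `MulAction` instance lives on the subtype of
  `CubicSurface.lines K F`.
* NOT here (natural named facts / theorems for later files, deliberately kept out of this
  fact-free definition file): the `27` lines and the existence of a `LineFrame` for smooth `F`;
  `dim V(F) = 5`; surjectivity of `W(E₆) → SO₅(𝔽₃)` and the image of `Gal(k̄/k)`; the
  discriminant `Δ(F)` and the spinor parity [ElsenhansJahnel2011, Thm 2.12].

## References

* [Hartshorne1977] R. Hartshorne, *Algebraic Geometry*, GTM 52 (1977), V §4: Prop 4.8, Thm 4.9,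
  Rem 4.10.1, Ex 4.11.
* [AllcockCarlsonToledo2002] D. Allcock, J. Carlson, D. Toledo, *The complex hyperbolic geometry
  of the moduli space of cubic surfaces*, J. Algebraic Geom. 11 (2002), (2.12), (3.2), (3.12),
  (4.8)–(4.10).
* [ElsenhansJahnel2011] A.-S. Elsenhans, J. Jahnel, *The discriminant of a cubic surface*,
  Geom. Dedicata 159 (2011), 1.1 and Thm 2.12.
* N. Bourbaki, *Groupes et algèbres de Lie*, Ch. VI §4, Exercice 2 (`E₆` mod `3`).
-/

noncomputable section

open scoped Pointwise Matrix
open Module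

namespace Literature.AlgebraicGeometry.CubicSurfaces

/-! ### Galois conjugation of linear subspaces of `K^ι` -/

section GalConj

variable {G : Type*} [Group G] {K : Type*} [Field K] [MulSemiringAction G K] {ι : Type*}

/-- The conjugate `σ • W = {v | σ⁻¹ • v ∈ W}` of a `K`-linear subspace `W ⊆ K^ι` under a group `G`
acting on the field `K` by ring automorphisms (coordinatewise action on `K^ι`; the action on
vectors is only *semilinear*, but the image of a subspace is again a subspace).
Used for `G = Gal(k̄/k)` acting on the lines of a cubic surface.
Ref: Elsenhans–Jahnel, *The discriminant of a cubic surface* (2011), 1.1. [folklore] -/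
def galConj (σ : G) (W : Submodule K (ι → K)) : Submodule K (ι → K) where
  carrier := {v | σ⁻¹ • v ∈ W}
  add_mem' {v w} hv hw := by simpa [smul_add] using W.add_mem hv hw
  zero_mem' := by simp
  smul_mem' c v hv := by
    have h : σ⁻¹ • (c • v) = (σ⁻¹ • c) • (σ⁻¹ • v) := by
      ext i; simp [Pi.smul_apply, smul_mul']
    simpa [h] using W.smul_mem (σ⁻¹ • c) hv

/-- Membership in the conjugate subspace. [folklore] -/
@[simp] theorem mem_galConj {σ : G} {W : Submodule K (ι → K)} {v : ι → K} :
    v ∈ galConj σ W ↔ σ⁻¹ • v ∈ W := Iff.rfl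

/-- `σ • v ∈ σ • W ↔ v ∈ W`. [folklore] -/
theorem smul_mem_galConj {σ : G} {W : Submodule K (ι → K)} {v : ι → K} :
    σ • v ∈ galConj σ W ↔ v ∈ W := by simp

/-- `1 • W = W`. [folklore] -/
@[simp] theorem galConj_one (W : Submodule K (ι → K)) : galConj (1 : G) W = W := by
  ext v; simp

/-- `(σ τ) • W = σ • (τ • W)`. [folklore] -/
theorem galConj_mul (σ τ : G) (W : Submodule K (ι → K)) :
    galConj (σ * τ) W = galConj σ (galConj τ W) := by
  ext v; simp [mul_smul]

/-- `galConj σ` is monotone. [folklore] -/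
theorem galConj_mono (σ : G) {W W' : Submodule K (ι → K)} (h : W ≤ W') :
    galConj σ W ≤ galConj σ W' := fun _ hv => h hv

variable (K ι) in
/-- Conjugation by `σ` as an automorphism of the lattice of subspaces of `K^ι`
(inverse: conjugation by `σ⁻¹`); in particular it preserves `⊓`, `⊥` and dimensions. [folklore] -/
def galConjOrderIso (σ : G) : Submodule K (ι → K) ≃o Submodule K (ι → K) where
  toFun := galConj σ
  invFun := galConj σ⁻¹
  left_inv W := by rw [← galConj_mul, inv_mul_cancel, galConj_one]
  right_inv W := by rw [← galConj_mul, mul_inv_cancel, galConj_one]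
  map_rel_iff' {W W'} := by
    change galConj σ W ≤ galConj σ W' ↔ W ≤ W'
    refine ⟨fun h => ?_, galConj_mono σ⟩
    have h' := galConj_mono σ⁻¹ h
    rwa [← galConj_mul, ← galConj_mul, inv_mul_cancel, galConj_one, galConj_one] at h'

/-- `galConjOrderIso` is `galConj`. [folklore] -/
@[simp] theorem galConjOrderIso_apply (σ : G) (W : Submodule K (ι → K)) :
    galConjOrderIso K ι σ W = galConj σ W := rfl

/-- Conjugation commutes with intersections. [folklore] -/
theorem galConj_inf (σ : G) (W W' : Submodule K (ι → K)) :
    galConj σ (W ⊓ W') = galConj σ W ⊓ galConj σ W' := (galConjOrderIso K ι σ).map_inf W W'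

/-- `σ • W = 0 ↔ W = 0`. [folklore] -/
@[simp] theorem galConj_eq_bot_iff (σ : G) (W : Submodule K (ι → K)) :
    galConj σ W = ⊥ ↔ W = ⊥ := by
  have h0 : galConj σ (⊥ : Submodule K (ι → K)) = ⊥ := by
    ext v; simp [smul_eq_zero_iff_eq]
  exact (galConjOrderIso K ι σ).injective.eq_iff' h0

/-- Conjugation preserves dimension: `v ↦ σ • v` is a `σ`-semilinear bijection `W → σ • W`.
[folklore] -/
theorem finrank_galConj (σ : G) (W : Submodule K (ι → K)) :
    finrank K (galConj σ W) = finrank K W := by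
  let j : W ≃+ galConj σ W :=
    { toFun := fun w => ⟨σ • (w : ι → K), smul_mem_galConj.2 w.2⟩
      invFun := fun w => ⟨σ⁻¹ • (w : ι → K), w.2⟩
      left_inv := fun w => by ext1; simp
      right_inv := fun w => by ext1; simp
      map_add' := fun v w => by ext1; simp [smul_add] }
  have h := rank_eq_of_equiv_equiv (fun c : K => σ • c) j (MulAction.bijective σ)
    (fun c w => by ext i; simp [j, smul_mul'])
  simpa [finrank] using congrArg Cardinal.toNat h.symm

end GalConj

namespace CubicSurface

/-! ### Smooth cubic forms and the lines of `F = 0` -/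

section Lines

variable {k : Type*} [Field k] (K : Type*) [Field K] [Algebra k K]

/-- A **smooth cubic form** in four variables over `k`: `F ∈ k[x₀,…,x₃]` homogeneous of degree
`3` such that `F` and its four partial derivatives have no common zero in `ℙ³(k̄)`, i.e. `F = 0` is
a smooth cubic surface.  Ref: Hartshorne, *Algebraic Geometry* (1977), I Ex. 5.8, V §4. [folklore] -/
def IsSmoothCubic (F : MvPolynomial (Fin 4) k) : Prop :=
  F.IsHomogeneous 3 ∧ ∀ v : Fin 4 → AlgebraicClosure k, v ≠ 0 → MvPolynomial.aeval v F = 0 →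
    ∃ i, MvPolynomial.aeval v (MvPolynomial.pderiv i F) ≠ 0

/-- The **lines** of the surface `F = 0` with coordinates in the extension field `K` of `k`
(intended: `K = k̄`): the `2`-dimensional linear subspaces `W ⊆ K⁴` (= lines of `ℙ³(K)`) on
which the form `F ∈ k[x₀,…,x₃]` vanishes identically.  For a smooth cubic form and `K`
algebraically closed there are exactly `27` of them (Cayley–Salmon).
Ref: Hartshorne, *Algebraic Geometry* (1977), V Thm 4.9. [cite: Hartshorne1977, V Thm 4.9] -/
def lines (F : MvPolynomial (Fin 4) k) : Set (Submodule K (Fin 4 → K)) :=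
  {W | finrank K W = 2 ∧ ∀ w ∈ W, MvPolynomial.aeval w F = 0}

variable {K}

/-- Membership in `lines K F`. [folklore] -/
theorem mem_lines {F : MvPolynomial (Fin 4) k} {W : Submodule K (Fin 4 → K)} :
    W ∈ lines K F ↔ finrank K W = 2 ∧ ∀ w ∈ W, MvPolynomial.aeval w F = 0 := Iff.rfl

variable {G : Type*} [Group G] [MulSemiringAction G K] [SMulCommClass G k K]

/-- Automorphisms of `K/k` map `K`-lines of `F = 0` (`F` with coefficients in `k`) to `K`-lines
of `F = 0`.  Ref: Elsenhans–Jahnel (2011), 1.1. [folklore] -/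
theorem galConj_mem_lines {F : MvPolynomial (Fin 4) k} {σ : G} {W : Submodule K (Fin 4 → K)} :
    galConj σ W ∈ lines K F ↔ W ∈ lines K F := by
  have key : ∀ (τ : G) (w : Fin 4 → K),
      MvPolynomial.aeval (τ • w) F = τ • MvPolynomial.aeval w F := fun τ w => by
    rw [show τ • MvPolynomial.aeval w F = MulSemiringAction.toAlgHom k K τ
        (MvPolynomial.aeval w F) from rfl, MvPolynomial.comp_aeval_apply]
    rfl
  simp only [mem_lines, finrank_galConj, mem_galConj]
  refine and_congr_right fun _ => ⟨fun h w hw => ?_, fun h w hw => ?_⟩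
  · have := h (σ • w) (by simpa using hw)
    rwa [key, smul_eq_zero_iff_eq] at this
  · have := h _ hw
    rwa [key, smul_eq_zero_iff_eq] at this

/-- The action of `G` (e.g. `Gal(k̄/k)`) on the set of `K`-lines of `F = 0` by conjugation.
Ref: Elsenhans–Jahnel (2011), 1.1. [folklore] -/
instance linesMulAction (F : MvPolynomial (Fin 4) k) : MulAction G (lines K F) where
  smul σ ℓ := ⟨galConj σ ℓ.1, galConj_mem_lines.2 ℓ.2⟩
  one_smul ℓ := Subtype.ext (galConj_one ℓ.1)
  mul_smul σ τ ℓ := Subtype.ext (galConj_mul σ τ ℓ.1)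

/-- Unfolding the action on lines. [folklore] -/
@[simp] theorem coe_smul_lines {F : MvPolynomial (Fin 4) k} (σ : G) (ℓ : lines K F) :
    ((σ • ℓ : lines K F) : Submodule K (Fin 4 → K)) = galConj σ ℓ.1 := rfl

end Lines

/-! ### The intersection form mod 3 and the quadratic `𝔽₃`-space of the lines -/

section QuadSpace

variable {k : Type*} [Field k] (K : Type*) [Field K] [Algebra k K] (F : MvPolynomial (Fin 4) k)
variable {G : Type*} [Group G] [MulSemiringAction G K] [SMulCommClass G k K]

open Classical in
/-- Intersection number of two lines `ℓ, ℓ'` of a smooth cubic surface, read off from their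
position: `ℓ·ℓ = -1`; for `ℓ ≠ ℓ'`, `ℓ·ℓ' = 1` if the lines meet (the planes `ℓ, ℓ' ⊆ K⁴` share
a nonzero vector) and `0` if they are skew.
Ref: Hartshorne (1977), V Thm 4.9 (`ℓ² = -1`), V Rem 4.10.1. [cite: Hartshorne1977, V Thm 4.9] -/
def interNum (ℓ ℓ' : lines K F) : ℤ :=
  if ℓ = ℓ' then -1 else if (ℓ.1 ⊓ ℓ'.1 : Submodule K (Fin 4 → K)) ≠ ⊥ then 1 else 0

variable {K F}

/-- The intersection numbers are symmetric. [folklore] -/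
theorem interNum_comm (ℓ ℓ' : lines K F) : interNum K F ℓ ℓ' = interNum K F ℓ' ℓ := by
  unfold interNum
  by_cases h : ℓ = ℓ'
  · subst h; rfl
  · rw [if_neg h, if_neg (Ne.symm h), inf_comm]

/-- The intersection numbers are invariant under automorphisms of `K/k`. [folklore] -/
theorem interNum_smul (σ : G) (ℓ ℓ' : lines K F) :
    interNum K F (σ • ℓ) (σ • ℓ') = interNum K F ℓ ℓ' := by
  unfold interNum
  simp only [smul_left_cancel_iff, coe_smul_lines, ← galConj_inf, ne_eq, galConj_eq_bot_iff]

variable (K F)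

/-- The intersection form reduced mod `3` on the free `𝔽₃`-module `𝔽₃^{(lines)}` on the lines
(the pull-back of the intersection form of `Pic(S) ⊗ 𝔽₃` along `𝔽₃^{(lines)} ↠ Pic(S) ⊗ 𝔽₃`,
the `27` lines generating `Pic S ≅ ℤ^{1,6}`): `B(e_ℓ, e_ℓ') = ℓ·ℓ' mod 3`.
Ref: Hartshorne (1977), V Prop 4.8, Thm 4.9; Allcock–Carlson–Toledo (2002), (4.8).
[cite: AllcockCarlsonToledo2002, (4.8)] -/
def interFormMod3 : LinearMap.BilinForm (ZMod 3) (lines K F →₀ ZMod 3) :=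
  Finsupp.lsum ℕ fun ℓ => LinearMap.toSpanSingleton (ZMod 3) _
    (Finsupp.linearCombination (ZMod 3) fun ℓ' => (interNum K F ℓ ℓ' : ZMod 3))

/-- `B(a e_ℓ, b e_ℓ') = a b (ℓ·ℓ')`. [folklore] -/
@[simp] theorem interFormMod3_single (ℓ ℓ' : lines K F) (a b : ZMod 3) :
    interFormMod3 K F (Finsupp.single ℓ a) (Finsupp.single ℓ' b) = a * b * interNum K F ℓ ℓ' := by
  simp [interFormMod3, mul_assoc]

/-- The mod-3 intersection form is symmetric. [folklore] -/
theorem interFormMod3_comm (x y : lines K F →₀ ZMod 3) :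
    interFormMod3 K F x y = interFormMod3 K F y x := by
  have h : (interFormMod3 K F).flip = interFormMod3 K F := by
    ext ℓ ℓ'
    simp only [LinearMap.BilinForm.flip_apply, LinearMap.coe_comp, Function.comp_apply,
      Finsupp.lsingle_apply, interFormMod3_single, interNum_comm ℓ' ℓ]
  calc interFormMod3 K F x y = (interFormMod3 K F).flip y x :=
        (LinearMap.BilinForm.flip_apply _ _ _).symm
    _ = interFormMod3 K F y x := by rw [h]

/-- The permutation representation of `G` on `𝔽₃^{(lines)}` (`e_ℓ ↦ e_{σℓ}`). [folklore] -/
def lineCombRep : Representation (ZMod 3) G (lines K F →₀ ZMod 3) where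
  toFun σ := Finsupp.lmapDomain (ZMod 3) (ZMod 3) (fun ℓ : lines K F => σ • ℓ)
  map_one' := by ext; simp
  map_mul' σ τ := by ext; simp [mul_smul]

/-- `σ • e_ℓ = e_{σ ℓ}`. [folklore] -/
@[simp] theorem lineCombRep_single (σ : G) (ℓ : lines K F) (a : ZMod 3) :
    lineCombRep K F σ (Finsupp.single ℓ a) = Finsupp.single (σ • ℓ) a := by
  simp [lineCombRep]

/-- The mod-3 intersection form is `G`-invariant. [folklore] -/
theorem interFormMod3_lineCombRep (σ : G) (x y : lines K F →₀ ZMod 3) :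
    interFormMod3 K F (lineCombRep K F σ x) (lineCombRep K F σ y) = interFormMod3 K F x y := by
  have h : (interFormMod3 K F).compl₁₂ (lineCombRep K F σ) (lineCombRep K F σ) =
      interFormMod3 K F := by
    ext ℓ ℓ'
    simp [interNum_smul]
  exact LinearMap.congr_fun₂ h x y

/-- The augmentation `𝔽₃^{(lines)} → 𝔽₃`, `e_ℓ ↦ 1` (= intersection with the hyperplane class
`h = -K_S` mod 3, since `h·ℓ = 1` for every line). [folklore] -/
def aug : (lines K F →₀ ZMod 3) →ₗ[ZMod 3] ZMod 3 :=
  Finsupp.lsum ℕ fun _ => LinearMap.id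

/-- `aug e_ℓ = 1`. [folklore] -/
@[simp] theorem aug_single (ℓ : lines K F) (a : ZMod 3) : aug K F (Finsupp.single ℓ a) = a := by
  simp [aug]

/-- The augmentation is `G`-invariant. [folklore] -/
@[simp] theorem aug_lineCombRep (σ : G) (x : lines K F →₀ ZMod 3) :
    aug K F (lineCombRep K F σ x) = aug K F x := by
  have h : aug K F ∘ₗ lineCombRep K F σ = aug K F := by ext ℓ; simp
  exact LinearMap.congr_fun h x

/-- The sum-zero submodule `N = ker(aug) ⊆ 𝔽₃^{(lines)}`: the classes orthogonal to the hyperplane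
class mod 3 (it maps onto `K_S^⊥ ⊗ 𝔽₃ = E₆ ⊗ 𝔽₃ ⊆ Pic(S) ⊗ 𝔽₃`).
Ref: Allcock–Carlson–Toledo (2002), (4.8) (`L₀(S) = η(S)^⊥`). [cite: AllcockCarlsonToledo2002, (4.8)] -/
def sumZero : Submodule (ZMod 3) (lines K F →₀ ZMod 3) := LinearMap.ker (aug K F)

/-- The mod-3 intersection form restricted to the sum-zero submodule `N`. [folklore] -/
def sumZeroForm : LinearMap.BilinForm (ZMod 3) (sumZero K F) :=
  (interFormMod3 K F).domRestrict₁₂ (sumZero K F) (sumZero K F)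

/-- The radical of the mod-3 intersection form on `N` (for a smooth cubic surface: the preimage
of the line `𝔽₃·h̄ = 3L₀'(S)/3L₀(S)`, of codimension `5` in `N`).
Ref: Allcock–Carlson–Toledo (2002), (4.8). [cite: AllcockCarlsonToledo2002, (4.8)] -/
def sumZeroRad : Submodule (ZMod 3) (sumZero K F) := LinearMap.ker (sumZeroForm K F)

/-- The **quadratic `𝔽₃`-space of the lines** `V(F) := N / rad(N)`: for a smooth cubic surface
`S = {F = 0}` this is Allcock–Carlson–Toledo's `V(S) = L₀(S)/3L₀'(S)`, `L₀(S) = K_S^⊥ ≅ E₆(-1)`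
in `Pic S`, a nondegenerate quadratic space of dimension `5` over `𝔽₃` on which
`Aut(Pic S, K_S) ≅ W(E₆)` acts faithfully (see the module docstring for the identification).
Ref: Allcock–Carlson–Toledo (2002), (2.12), (4.8); Bourbaki, *Lie* VI §4 Ex. 2.
[cite: AllcockCarlsonToledo2002, (4.8)] -/
abbrev LinesQuadSpace : Type _ := sumZero K F ⧸ sumZeroRad K F

/-- The nondegenerate symmetric bilinear form `q` on `V(F) = N / rad(N)` induced by the mod-3
intersection form.  Ref: Allcock–Carlson–Toledo (2002), (2.12), (4.8).
[cite: AllcockCarlsonToledo2002, (4.8)] -/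
def linesQuadForm : LinearMap.BilinForm (ZMod 3) (LinesQuadSpace K F) :=
  ((sumZeroRad K F).liftQ ((sumZeroRad K F).liftQ (sumZeroForm K F) le_rfl).flip fun y hy => by
    rw [LinearMap.mem_ker]
    refine LinearMap.ext fun v => Submodule.Quotient.induction_on _ v fun x => ?_
    change interFormMod3 K F x y = 0
    rw [interFormMod3_comm]
    exact LinearMap.congr_fun (LinearMap.mem_ker.1 hy) x).flip

/-- `q([x], [y]) = B(x, y)`. [folklore] -/
@[simp] theorem linesQuadForm_mk (x y : sumZero K F) :
    linesQuadForm K F (Submodule.Quotient.mk x) (Submodule.Quotient.mk y) =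
      interFormMod3 K F x y := rfl

/-- `q` is nondegenerate (by construction: we divided by the radical). [folklore] -/
theorem linesQuadForm_nondegenerate : (linesQuadForm K F).Nondegenerate := by
  refine ⟨fun v hv => ?_, fun v hv => ?_⟩ <;>
    induction v using Submodule.Quotient.induction_on with | _ x => ?_ <;>
    refine (Submodule.Quotient.mk_eq_zero _).2 (LinearMap.mem_ker.2 (LinearMap.ext fun y => ?_))
  · exact hv (Submodule.Quotient.mk y)
  · change interFormMod3 K F x y = 0
    rw [interFormMod3_comm]
    exact hv (Submodule.Quotient.mk y)

/-- The permutation representation restricted to the sum-zero submodule `N`. [folklore] -/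
def sumZeroRep : Representation (ZMod 3) G (sumZero K F) :=
  (lineCombRep K F).subrepresentation (sumZero K F) fun σ x hx => by
    simpa [sumZero] using hx

/-- The representation of `G` on the quadratic space `V(F) = N / rad(N)` of the lines
(for `G = Gal(k̄/k)` and `F` smooth: the Galois action on `K_S^⊥ ⊗ 𝔽₃` modulo its radical,
with values in the orthogonal group `O(V(F), q) = W(E₆) × {±1}`).
Ref: Allcock–Carlson–Toledo (2002), (3.12), (4.8). [cite: AllcockCarlsonToledo2002, (4.8)] -/
def linesQuadRep : Representation (ZMod 3) G (LinesQuadSpace K F) :=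
  (sumZeroRep K F).quotient (sumZeroRad K F) fun σ x hx => by
    rw [Submodule.mem_comap]
    refine LinearMap.mem_ker.2 (LinearMap.ext fun y => ?_)
    have hy : y = sumZeroRep K F σ (sumZeroRep K F σ⁻¹ y) := by
      rw [← Module.End.mul_apply, ← map_mul, mul_inv_cancel, map_one, Module.End.one_apply]
    rw [hy]
    change interFormMod3 K F (lineCombRep K F σ x) (lineCombRep K F σ _) = 0
    rw [interFormMod3_lineCombRep]
    exact LinearMap.congr_fun (LinearMap.mem_ker.1 hx) _

/-- `σ • [x] = [σ • x]` on `V(F)`. [folklore] -/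
@[simp] theorem linesQuadRep_mk (σ : G) (x : sumZero K F) :
    linesQuadRep K F σ (Submodule.Quotient.mk x) = Submodule.Quotient.mk (sumZeroRep K F σ x) :=
  rfl

/-- The representation on `V(F)` preserves the form `q`. [folklore] -/
theorem linesQuadForm_linesQuadRep (σ : G) (v w : LinesQuadSpace K F) :
    linesQuadForm K F (linesQuadRep K F σ v) (linesQuadRep K F σ w) = linesQuadForm K F v w := by
  induction v using Submodule.Quotient.induction_on with | _ x => ?_
  induction w using Submodule.Quotient.induction_on with | _ y => ?_
  exact interFormMod3_lineCombRep K F σ x y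

/-- An element acting trivially on the lines acts trivially on `V(F)`. [folklore] -/
theorem linesQuadRep_eq_one {σ : G} (h : ∀ ℓ : lines K F, σ • ℓ = ℓ) : linesQuadRep K F σ = 1 := by
  have h1 : lineCombRep K F σ = 1 := by ext ℓ; simp [h]
  refine Submodule.linearMap_qext _ (LinearMap.ext fun x => ?_)
  change Submodule.Quotient.mk (sumZeroRep K F σ x) = Submodule.Quotient.mk x
  congr 1
  exact Subtype.ext (by simp [sumZeroRep, h1])

end QuadSpace

/-! ### Frames and the `SO₅(𝔽₃)`-valued Galois representation -/

section DetTwist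

variable (n : Type*) [Fintype n] [DecidableEq n] (R : Type*) [CommRing R]

/-- The monoid endomorphism `M ↦ det(M)·M` of `Mₙ(R)` (multiplicative because scalars are
central and `det` is multiplicative). [folklore] -/
def detTwistMatrix : Matrix n n R →* Matrix n n R where
  toFun M := M.det • M
  map_one' := by simp
  map_mul' M N := by
    simp only [Matrix.det_mul, smul_mul_assoc, mul_smul_comm, smul_smul, mul_comm]

/-- The twist `g ↦ det(g)·g` on `GLₙ(R)` (a group homomorphism since scalars are central).  For
`n = 5`, `R = 𝔽₃` it maps the image `{g ∈ O₅(𝔽₃) | det g = spinor norm of g}` of `W(E₆)`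
isomorphically onto `SO₅(𝔽₃)`.  Ref: Allcock–Carlson–Toledo (2002), (3.12)
(`P Aut(V) = PGO₅(3) ≅ W(E₆)`, citing the ATLAS, p. 26). [folklore] -/
def detTwist : GL n R →* GL n R := Units.map (detTwistMatrix n R)

/-- `detTwist g = det(g) • g` as a matrix. [folklore] -/
@[simp] theorem coe_detTwist (g : GL n R) :
    ((detTwist n R g : GL n R) : Matrix n n R) = (g : Matrix n n R).det • (g : Matrix n n R) := rfl

/-- The twist of an orthogonal matrix is orthogonal. [folklore] -/
theorem transpose_mul_detTwist {g : GL n R} (h : (g : Matrix n n R)ᵀ * g = 1) :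
    ((detTwist n R g : GL n R) : Matrix n n R)ᵀ * (detTwist n R g : GL n R) = 1 := by
  have hd : (g : Matrix n n R).det * (g : Matrix n n R).det = 1 := by
    simpa [Matrix.det_transpose] using congrArg Matrix.det h
  simp [Matrix.transpose_smul, smul_smul, hd, h]

/-- `det(det(g)·g) = det(g)^(n+1)`. [folklore] -/
theorem det_detTwist (g : GL n R) :
    ((detTwist n R g : GL n R) : Matrix n n R).det =
      (g : Matrix n n R).det ^ (Fintype.card n + 1) := by
  simp [pow_succ]

end DetTwist

section Frame

variable {k : Type*} [Field k] (K : Type*) [Field K] [Algebra k K] (F : MvPolynomial (Fin 4) k)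
variable {G : Type*} [Group G] [MulSemiringAction G K] [SMulCommClass G k K]

/-- An **orthonormal-type frame** of the quadratic space `(V(F), q)` of the lines: a basis
`b = (b₁,…,b₅)` of `V(F)` over `𝔽₃` in which `q` is a unit multiple of the sum-of-squares form,
`b-coords(x) · b-coords(y) = c · q(x, y)`.  Such a frame exists iff `V(F)` is `5`-dimensional
(every nondegenerate quadratic space of odd dimension over `𝔽₃` is a scalar multiple of the split
form), which holds for every smooth cubic form (`27` lines, `K_S^⊥ ≅ E₆(-1)` of discriminant `3`);
it is the mod-3 shadow of a marking `Pic S ≅ ℤ^{1,6}`.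
Ref: Allcock–Carlson–Toledo (2002), (3.2), (4.8). [cite: AllcockCarlsonToledo2002, (4.8)] -/
structure LineFrame where
  /-- the basis of `V(F)` -/
  basis : Basis (Fin 5) (ZMod 3) (LinesQuadSpace K F)
  /-- the unit `c` with `coords · coords = c · q` -/
  scale : (ZMod 3)ˣ
  /-- in `b`-coordinates `q` is `c⁻¹ ·` (sum of squares) -/
  compat : ∀ x y : LinesQuadSpace K F,
    ⇑(basis.repr x) ⬝ᵥ ⇑(basis.repr y) = scale * linesQuadForm K F x y

variable {K F}

/-- The matrix representation `σ ↦ [σ]_b ∈ M₅(𝔽₃)` of `G` on `V(F)` in the frame `b`. [folklore] -/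
def LineFrame.matrixRep (fr : LineFrame K F) : G →* Matrix (Fin 5) (Fin 5) (ZMod 3) where
  toFun σ := LinearMap.toMatrix fr.basis fr.basis (linesQuadRep K F σ)
  map_one' := by rw [map_one, LinearMap.toMatrix_one]
  map_mul' σ τ := by rw [map_mul, LinearMap.toMatrix_mul]

/-- In an orthonormal-type frame the matrices of the (`q`-preserving) action are orthogonal:
`[σ]ᵀ [σ] = 1`. [folklore] -/
theorem LineFrame.transpose_mul_matrixRep (fr : LineFrame K F) (σ : G) :
    (fr.matrixRep σ)ᵀ * fr.matrixRep σ = 1 := by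
  set A := fr.matrixRep (G := G) σ with hA
  have h : ∀ u v : Fin 5 → ZMod 3, (A *ᵥ u) ⬝ᵥ (A *ᵥ v) = u ⬝ᵥ v := fun u v => by
    obtain ⟨x, rfl⟩ : ∃ x, ⇑(fr.basis.repr x) = u :=
      ⟨fr.basis.equivFun.symm u, by rw [← Basis.equivFun_apply, LinearEquiv.apply_symm_apply]⟩
    obtain ⟨y, rfl⟩ : ∃ y, ⇑(fr.basis.repr y) = v :=
      ⟨fr.basis.equivFun.symm v, by rw [← Basis.equivFun_apply, LinearEquiv.apply_symm_apply]⟩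
    rw [hA, LineFrame.matrixRep, MonoidHom.coe_mk, OneHom.coe_mk, LinearMap.toMatrix_mulVec_repr,
      LinearMap.toMatrix_mulVec_repr, fr.compat, fr.compat, linesQuadForm_linesQuadRep]
  have key : ∀ u v : Fin 5 → ZMod 3, u ⬝ᵥ ((Aᵀ * A) *ᵥ v) = u ⬝ᵥ ((1 : Matrix _ _ (ZMod 3)) *ᵥ v) :=
    fun u v => by
      rw [← Matrix.mulVec_mulVec, Matrix.dotProduct_mulVec u Aᵀ (A *ᵥ v), Matrix.vecMul_transpose,
        h, Matrix.one_mulVec]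
  exact Matrix.toBilin'.injective (LinearMap.ext₂ fun u v => by
    rw [Matrix.toBilin'_apply', Matrix.toBilin'_apply', key])

/-- The determinant of the matrix of `σ` in an orthonormal-type frame squares to `1`. [folklore] -/
theorem LineFrame.det_matrixRep_sq (fr : LineFrame K F) (σ : G) :
    (fr.matrixRep σ).det ^ 2 = 1 := by
  simpa [Matrix.det_transpose, pow_two] using congrArg Matrix.det (fr.transpose_mul_matrixRep σ)

/-- The `SO₅(𝔽₃)`-valued homomorphism `σ ↦ det([σ]_b)·[σ]_b` attached to a frame `b`
(abstract group `G` of automorphisms of `K/k`; no topology). [folklore] -/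
def LineFrame.orthogonalRep (fr : LineFrame K F) : G →* GL (Fin 5) (ZMod 3) :=
  (detTwist (Fin 5) (ZMod 3)).comp fr.matrixRep.toHomUnits

/-- Values of `orthogonalRep` are orthogonal matrices. [folklore] -/
theorem LineFrame.transpose_mul_orthogonalRep (fr : LineFrame K F) (σ : G) :
    ((fr.orthogonalRep σ : GL (Fin 5) (ZMod 3)) : Matrix (Fin 5) (Fin 5) (ZMod 3))ᵀ *
      (fr.orthogonalRep σ : GL (Fin 5) (ZMod 3)) = 1 :=
  transpose_mul_detTwist _ _ (by simpa using fr.transpose_mul_matrixRep σ)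

/-- Values of `orthogonalRep` have determinant `1` (`det(det g · g) = det(g)⁶ = 1`). [folklore] -/
theorem LineFrame.det_orthogonalRep (fr : LineFrame K F) (σ : G) :
    ((fr.orthogonalRep σ : GL (Fin 5) (ZMod 3)) : Matrix (Fin 5) (Fin 5) (ZMod 3)).det = 1 := by
  rw [LineFrame.orthogonalRep, MonoidHom.comp_apply, det_detTwist]
  simp only [MonoidHom.coe_toHomUnits, Fintype.card_fin]
  rw [show 5 + 1 = 2 * 3 by rfl, pow_mul, fr.det_matrixRep_sq, one_pow]

/-- An element acting trivially on the lines is in the kernel of `orthogonalRep`. [folklore] -/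
theorem LineFrame.orthogonalRep_eq_one (fr : LineFrame K F) {σ : G} (h : ∀ ℓ : lines K F, σ • ℓ = ℓ) :
    fr.orthogonalRep σ = 1 := by
  have h1 : fr.matrixRep.toHomUnits σ = 1 := Units.ext (by
    simp [LineFrame.matrixRep, linesQuadRep_eq_one K F h])
  rw [LineFrame.orthogonalRep, MonoidHom.comp_apply, h1, map_one]

end Frame

/-! ### The Galois representation -/

section Galois

open Field

variable {k : Type*} [Field k] (F : MvPolynomial (Fin 4) k)

/-- The stabilizer in `Gal(k̄/k)` of a `k̄`-linear subspace `W ⊆ k̄^ι` (`ι` finite) is open in the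
Krull topology: it contains `Gal(k̄/E)` for the finite extension `E/k` generated by the coordinates
of a finite spanning set of `W`.  Ref: Neukirch, *Algebraic Number Theory* (1999), IV §1. [folklore] -/
theorem isOpen_setOf_galConj_eq {ι : Type*} [Finite ι]
    (W : Submodule (AlgebraicClosure k) (ι → AlgebraicClosure k)) :
    IsOpen {σ : AlgebraicClosure k ≃ₐ[k] AlgebraicClosure k | galConj σ W = W} := by
  classical
  obtain ⟨S, hS⟩ : W.FG := IsNoetherian.noetherian W
  set T : Set (AlgebraicClosure k) := ⋃ v ∈ (S : Set (ι → AlgebraicClosure k)), Set.range v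
  haveI : Finite T := (S.finite_toSet.biUnion fun v _ => Set.finite_range v).to_subtype
  set E : IntermediateField k (AlgebraicClosure k) := IntermediateField.adjoin k T
  haveI : FiniteDimensional k E := IntermediateField.finiteDimensional_adjoin
    fun x _ => (Algebra.IsAlgebraic.isAlgebraic x).isIntegral
  -- `Gal(k̄/E)` fixes every vector of `S`, hence stabilizes `W = span S`.
  have hfix : ∀ σ : AlgebraicClosure k ≃ₐ[k] AlgebraicClosure k, σ ∈ E.fixingSubgroup →
      ∀ v ∈ (S : Set (ι → AlgebraicClosure k)), σ • v = v := by
    intro σ hσ v hv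
    ext i
    exact (IntermediateField.mem_fixingSubgroup_iff E σ).1 hσ (v i)
      (IntermediateField.subset_adjoin k T (Set.mem_biUnion hv (Set.mem_range_self i)))
  have hsub : ∀ σ : AlgebraicClosure k ≃ₐ[k] AlgebraicClosure k, σ ∈ E.fixingSubgroup →
      galConj σ W = W := by
    intro σ hσ
    have hle : W ≤ galConj σ W := by
      rw [← hS]
      refine Submodule.span_le.2 fun v hv => ?_
      have h1 : σ⁻¹ • v = v := hfix σ⁻¹ (E.fixingSubgroup.inv_mem hσ) v hv
      simpa [mem_galConj, h1] using Submodule.subset_span hv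
    exact (Submodule.eq_of_le_of_finrank_eq hle (finrank_galConj σ W).symm).symm
  rw [isOpen_iff_forall_mem_open]
  intro σ hσ
  refine ⟨σ • (E.fixingSubgroup : Set (AlgebraicClosure k ≃ₐ[k] AlgebraicClosure k)), ?_,
    E.fixingSubgroup_isOpen.leftCoset σ, ⟨1, E.fixingSubgroup.one_mem, mul_one σ⟩⟩
  rintro _ ⟨τ, hτ, rfl⟩
  show galConj (σ * τ) W = W
  rw [galConj_mul, hsub τ hτ]
  exact hσ

/-- The pointwise stabilizer of the lines is open in `Aut(k̄/k)` when there are finitely many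
lines (e.g. `27`).  [folklore] -/
theorem isOpen_setOf_forall_smul_lines_eq (hfin : (lines (AlgebraicClosure k) F).Finite) :
    IsOpen {σ : AlgebraicClosure k ≃ₐ[k] AlgebraicClosure k |
      ∀ ℓ : lines (AlgebraicClosure k) F, σ • ℓ = ℓ} := by
  have h := hfin.isOpen_biInter fun W _ => isOpen_setOf_galConj_eq W
  convert h using 1
  ext σ
  simp only [Set.mem_setOf_eq, Set.mem_iInter, Subtype.forall, Subtype.ext_iff, coe_smul_lines]

/-- The same openness statement in Mathlib's `Field.absoluteGaloisGroup k` (definitionally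
`k̄ ≃ₐ[k] k̄` with the Krull topology and the transported action of
`Literature.NumberTheory.GaloisRepresentations.AbsGaloisGroup`). [folklore] -/
theorem isOpen_setOf_forall_smul_lines_eq' (hfin : (lines (AlgebraicClosure k) F).Finite) :
    IsOpen {σ : absoluteGaloisGroup k | ∀ ℓ : lines (AlgebraicClosure k) F, σ • ℓ = ℓ} :=
  isOpen_setOf_forall_smul_lines_eq F hfin

variable {F} in
/-- The framed representation attached to a frame, as a *continuous* homomorphism
`Gal(k̄/k) →ₜ* GL₅(𝔽₃)`: it is trivial on the open pointwise stabilizer `U` of the (finitely many)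
lines, so the preimage of any set is a union of cosets `σU`.  [folklore] -/
def LineFrame.galoisRep (hfin : (lines (AlgebraicClosure k) F).Finite)
    (fr : LineFrame (AlgebraicClosure k) F) :
    NumberTheory.GaloisRepresentations.FramedGaloisRep k (ZMod 3) 5 where
  toMonoidHom := fr.orthogonalRep
  continuous_toFun := by
    refine continuous_def.2 fun s _ => (isOpen_iff_forall_mem_open.2 fun σ hσ => ?_)
    refine ⟨σ • {τ : absoluteGaloisGroup k | ∀ ℓ : lines (AlgebraicClosure k) F, τ • ℓ = ℓ}, ?_,
      (isOpen_setOf_forall_smul_lines_eq' F hfin).leftCoset σ,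
      ⟨1, fun ℓ => one_smul _ ℓ, mul_one σ⟩⟩
    rintro _ ⟨τ, hτ, rfl⟩
    show fr.orthogonalRep (σ * τ) ∈ s
    rw [map_mul, fr.orthogonalRep_eq_one hτ, mul_one]
    exact hσ

open Classical in
/-- **The mod-3 orthogonal Galois representation of the lines of a cubic surface.**
For a cubic form `F ∈ k[x₀,…,x₃]` (intended: smooth, `k = ℚ`), `Gal(k̄/k)` permutes the lines of
`F = 0` over `k̄` preserving intersection numbers, hence acts on
`V(F) = (K_S^⊥ ⊗ 𝔽₃)/radical` (`K_S^⊥ ≅ E₆(-1)` in `Pic S_{k̄}`, `dim V(F) = 5`, nondegenerate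
quadratic form `q`) through `Aut(Pic, K_S) = W(E₆) ↪ O(V(F), q) = W(E₆) × {±1}`
(Allcock–Carlson–Toledo (3.12), (4.8): `P Aut(V) = PGO₅(3) ≅ W(E₆)`).  In a chosen
orthonormal-type frame of `(V(F), q)` write `w_σ ∈ O₅(𝔽₃)` for the matrix of `σ`; the definition
is `σ ↦ det(w_σ)·w_σ ∈ SO₅(𝔽₃) = {g | gᵀg = 1, det g = 1}` (`g ↦ det(g)g` restricts to the
isomorphism `W(E₆) ≅ SO₅(𝔽₃)`).  Well defined up to conjugation by `O₅(𝔽₃)` (choice of frame,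
`Classical.choice`).  JUNK VALUE: the trivial representation when the set of lines is infinite or
`(V(F), q)` admits no orthonormal-type frame — neither happens for a smooth cubic form (`27` lines,
`V(F)` nondegenerate of dimension `5`), by the theorem of the 27 lines.
Ref: Allcock–Carlson–Toledo, *J. Algebraic Geom.* 11 (2002), (2.12), (3.2), (3.12), (4.8);
Hartshorne (1977), V 4.8–4.10.1; Elsenhans–Jahnel (2011), Thm 2.12 (spinor parity).
[cite: AllcockCarlsonToledo2002, (4.8)] -/
def linesOrthogonalRep : NumberTheory.GaloisRepresentations.FramedGaloisRep k (ZMod 3) 5 :=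
  if h : (lines (AlgebraicClosure k) F).Finite ∧ Nonempty (LineFrame (AlgebraicClosure k) F) then
    (Classical.choice h.2).galoisRep h.1
  else 1

/-- Unfolding `linesOrthogonalRep` in the geometric case (finitely many lines, a frame exists):
it is the framed representation of the chosen frame. [folklore] -/
theorem linesOrthogonalRep_eq
    (h : (lines (AlgebraicClosure k) F).Finite ∧ Nonempty (LineFrame (AlgebraicClosure k) F)) :
    linesOrthogonalRep F = (Classical.choice h.2).galoisRep h.1 := by
  classical
  exact dif_pos h

/-- The values of `linesOrthogonalRep` are orthogonal: `ρ(σ)ᵀ ρ(σ) = 1`. [folklore] -/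
theorem transpose_mul_linesOrthogonalRep (σ : absoluteGaloisGroup k) :
    ((linesOrthogonalRep F σ : GL (Fin 5) (ZMod 3)) : Matrix (Fin 5) (Fin 5) (ZMod 3))ᵀ *
      (linesOrthogonalRep F σ : GL (Fin 5) (ZMod 3)) = 1 := by
  classical
  unfold linesOrthogonalRep
  split_ifs with h
  · exact (Classical.choice h.2).transpose_mul_orthogonalRep σ
  · simp [show (1 : NumberTheory.GaloisRepresentations.FramedGaloisRep k (ZMod 3) 5) σ = 1 from rfl]

/-- The values of `linesOrthogonalRep` have determinant `1`. [folklore] -/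
theorem det_linesOrthogonalRep (σ : absoluteGaloisGroup k) :
    ((linesOrthogonalRep F σ : GL (Fin 5) (ZMod 3)) : Matrix (Fin 5) (Fin 5) (ZMod 3)).det = 1 := by
  classical
  unfold linesOrthogonalRep
  split_ifs with h
  · exact (Classical.choice h.2).det_orthogonalRep σ
  · simp [show (1 : NumberTheory.GaloisRepresentations.FramedGaloisRep k (ZMod 3) 5) σ = 1 from rfl]

/-- `σ ∈ Gal(k̄/k)` fixing every line of `F = 0` lies in the kernel of `linesOrthogonalRep`
(so the representation factors through `Gal(k(lines)/k) ≤ W(E₆)`). [folklore] -/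
theorem linesOrthogonalRep_eq_one_of_forall_smul_eq {σ : absoluteGaloisGroup k}
    (hσ : ∀ ℓ : lines (AlgebraicClosure k) F, σ • ℓ = ℓ) : linesOrthogonalRep F σ = 1 := by
  classical
  unfold linesOrthogonalRep
  split_ifs with h
  · exact (Classical.choice h.2).orthogonalRep_eq_one hσ
  · rfl

end Galois

end CubicSurface

end Literature.AlgebraicGeometry.CubicSurfaces
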